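import Literature.NumberTheory.GaloisCohomology.TateGlobalEulerCharacteristicReadings
import Literature.NumberTheory.GaloisRepresentations.ContinuousCohomologyEulerPrimaryReduction
import HarnessLib

/-!
# Tate's global Euler–Poincaré characteristic at a TOTALLY COMPLEX `K` FROM its `p`-primary cases
# (Milne ADT I Thm. 5.1, NSW (8.7.4): reduction to `p`-primary coefficient modules)

Topic `NumberTheory/GaloisCohomology`; namespace `Literature.NumberTheory.GaloisCohomology`.
THEOREMS ONLY (no definition, no named fact, no `sorry`, no instance; D-0026).

`TateGlobalEulerCharacteristic.lean` vendors Tate's global Euler–Poincaré characteristic formula as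
the named fact `tateGlobalEulerPoincareCharacteristic K`; at a totally complex `K` it reads
`#H⁰(G_S, M) · #H²(G_S, M) · #M^{r₂} = #H¹(G_S, M)` (`TateGlobalEulerCharacteristicReadings.lean`).
Both sides are multiplicative in `M`, in particular along the primary decomposition
`M = ⊕_ℓ M[ℓ^∞]` of a finite `Γ_K`-module, so the formula for every finite `M` follows from the
formula for the `ℓ`-PRIMARY finite modules, `ℓ` over the primes dividing `#M` — for which `S ⊇ S_ℓ`
by the fact's own hypothesis "every place dividing `#M` lies in `S`".  This is the first reduction
in every proof of the formula (Milne: "we may assume that `M` is killed by a prime"; NSW (8.7.4)).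

* **`tateGlobalEulerPoincareCharacteristic_of_isTotallyComplex_of_forall_prime`** — the named fact
  at a totally complex `K` FROM its `p`-primary instances (`S ⊇ S_p` finite, `M` finite discrete
  `p`-primary unramified outside `S`, conclusion `#H⁰ · #H² · #M^{r₂} = #H¹` in `restrictedCohomology`
  currency), for all primes `p`: the generic reduction `euler_of_forall_prime_primary`
  (`ContinuousCohomologyEulerPrimaryReduction.lean`) applied to the `G_S`-module `M^{N_S} = M`
  (`GaloisGroupUnramifiedOutside K S`, `DiscreteGaloisModule.quotientInvariants`), the hypothesis
  being fed through the inflation `Γ_K ↠ G_S` (`isUnramifiedOutside_inflate`,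
  `nonempty_restrictedCohomology_addEquiv_H` of `RestrictedRamificationFiniteCoefficients.lean`),
  and the complex-place bookkeeping of `TateGlobalEulerCharacteristicReadings.lean`
  (`∏_w #M^{mult w} = #M^{2 r₂}`, `∏_w #H⁰(K_w, M) = #M^{r₂}`).

HONEST FRAMING: a reduction between instances of ONE named fact (all finite `M` ⇐ `p`-primary `M`)
at a totally complex `K`; no case of Tate's formula itself is proved here.  Serves cell `bsd-eis`,
crux `GoodLatticeBDPValue` (stmt-BirchSwinnertonDyer-19032), lane «TATE-EPC-TC» brick B0 — the
per-prime statements in exactly this binder shape are the lane's bricks B1/B3b/B8.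

## References
* J. S. Milne, *Arithmetic Duality Theorems*, 2nd ed. (2006), Ch. I §5, Thm. 5.1 and its proof,
  with footnote 13 (p. 67). [MilneADT2006]
* J. Neukirch, A. Schmidt, K. Wingberg, *Cohomology of Number Fields*, 2nd ed. (2008), (8.7.4) and
  its proof. [NeukirchSchmidtWingberg2008]
-/

noncomputable section

namespace Literature.NumberTheory.GaloisCohomology

open NumberField IsDedekindDomain
open scoped NumberField
open Literature.NumberTheory.GaloisRepresentations
open Literature.NumberTheory.GaloisRepresentations.DiscreteGaloisModule (restrictedCohomology)

/-- **Tate's global Euler–Poincaré characteristic formula at a TOTALLY COMPLEX `K` follows from its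
`p`-primary instances.**  If for every prime `p`, every finite `S ⊇ S_p` and every finite discrete
`p`-primary `Γ_K`-module `M` unramified outside `S` one has
`#H⁰(G_S, M) · #H²(G_S, M) · #M^{r₂} = #H¹(G_S, M)` (`r₂ = nrComplexPlaces K`), then the named fact
`tateGlobalEulerPoincareCharacteristic K` holds: for a finite `M` with every place dividing `#M` in
`S`, every prime `p ∣ #M` has `S ⊇ S_p`, the `G_S`-module `M = M^{N_S}` obeys the identity by the
primary reduction `euler_of_forall_prime_primary` (its `p`-primary pieces, inflated along
`Γ_K ↠ G_S`, are unramified outside `S`), and at a totally complex `K` the fact's archimedean factors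
read `∏_w #M^{mult w} = #M^{2 r₂}`, `∏_w #H⁰(K_w, M) = #M^{r₂}`.
[cite: MilneADT2006, Ch. I §5, Thm. 5.1 and its proof, with footnote 13 (p. 67)]
[cite: NeukirchSchmidtWingberg2008, (8.7.4) (proof)] -/
theorem tateGlobalEulerPoincareCharacteristic_of_isTotallyComplex_of_forall_prime (K : Type)
    [Field K] [NumberField K] [IsTotallyComplex K]
    (h : ∀ p : ℕ, p.Prime → ∀ (S : Set (HeightOneSpectrum (𝓞 K))), S.Finite →
      ∀ (M : Type) [AddCommGroup M] [TopologicalSpace M] [DiscreteTopology M] [Finite M]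
        (ρ : DiscreteGaloisModule K M), GaloisRep.IsUnramifiedOutside S ρ →
        (∀ v : HeightOneSpectrum (𝓞 K), ((p : ℕ) : 𝓞 K) ∈ v.asIdeal → v ∈ S) →
        Literature.NumberTheory.GaloisRepresentations.IsPrimaryTorsion p M →
        Nat.card (restrictedCohomology ρ S 0) * Nat.card (restrictedCohomology ρ S 2) *
            Nat.card M ^ InfinitePlace.nrComplexPlaces K =
          Nat.card (restrictedCohomology ρ S 1)) :
    tateGlobalEulerPoincareCharacteristic K := by
  intro S hS M _ _ _ _ ρ hur hcard
  have hK : ∀ w : InfinitePlace K, w.IsComplex := fun w => IsTotallyComplex.isComplex w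
  rw [prod_natCard_galoisCohomology_zero_toLocal_inl_of_forall_isComplex ρ hK,
    prod_natCard_pow_mult_of_forall_isComplex hK,
    card_infinitePlace_eq_nrComplexPlaces_of_forall_isComplex hK, two_mul, pow_add, ← mul_assoc]
  suffices hE : Nat.card (restrictedCohomology ρ S 0) * Nat.card (restrictedCohomology ρ S 2) *
      Nat.card M ^ InfinitePlace.nrComplexPlaces K = Nat.card (restrictedCohomology ρ S 1) by
    rw [hE]
  -- the `G_S`-module `M^{N_S} = M`
  have hker : ramificationSubgroup K S ≤ ContinuousRep.ker ρ :=
    (DiscreteGaloisModule.isUnramifiedOutside_iff_ramificationSubgroup_le_ker ρ S).1 hur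
  have hinv : Nat.card
      (Representation.invariants (ρ.toRepresentation.comp (ramificationSubgroup K S).subtype)) =
        Nat.card M :=
    Nat.card_congr (ρ.invariantsRamificationEquiv hker).toEquiv
  rw [← hinv]
  refine euler_of_forall_prime_primary (InfinitePlace.nrComplexPlaces K)
    (ρ.quotientInvariants (ramificationSubgroup K S)) fun p hp hpM B _ _ _ _ τ hτ => ?_
  -- every place above `p ∣ #M` lies in `S`
  have hSp : ∀ v : HeightOneSpectrum (𝓞 K), ((p : ℕ) : 𝓞 K) ∈ v.asIdeal → v ∈ S := fun v hv => by
    refine hcard v ?_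
    rw [hinv] at hpM
    obtain ⟨c, hc⟩ := hpM
    rw [hc, Nat.cast_mul]
    exact v.asIdeal.mul_mem_right _ hv
  -- the hypothesis for the inflated module, read back in `Hⁿ(G_S, B)`
  have hB := h p hp S hS B ((τ.restrictScalars ℤ).restrict (toUnramifiedQuotCont K S))
    (isUnramifiedOutside_inflate S τ) hSp hτ
  obtain ⟨e₀⟩ := nonempty_restrictedCohomology_addEquiv_H S τ 0
  obtain ⟨e₁⟩ := nonempty_restrictedCohomology_addEquiv_H S τ 1
  obtain ⟨e₂⟩ := nonempty_restrictedCohomology_addEquiv_H S τ 2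
  rw [Nat.card_congr e₀.toEquiv, Nat.card_congr e₁.toEquiv, Nat.card_congr e₂.toEquiv] at hB
  exact hB

end Literature.NumberTheory.GaloisCohomology

end
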